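import Literature.Probability.LatticeModels.IsingDisorderLaplacian
import HarnessLib

/-!
# Signed sections of the critical Kadanoff–Ceva fermion and their s-holomorphicity

Topic `Literature/Probability/LatticeModels`. Third brick of the lattice side of the programme
behind `Literature.Probability.LatticeModels.chi_onePoint_rho` (Chelkak–Hongler–Izyurov 2015,
"CHI15"), continuing `IsingDisorderFermion.lean` (Kadanoff–Ceva corner values
`X_B(v,T) = ⟨μ_T σ_v σ_B⟩`, CHI21 Def. 2.8) and `IsingDisorderLaplacian.lean` (admissible cut
systems). The corner values are functions of the plaquette only up to sign (gauge moves,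
`kcCorner_symmDiff_edgeBoundary`); CHI15's spinor observable `F_{[Ω_δ,a]}` (Def. 2.1, Prop. 2.4) is
a genuine function on a double cover. This file constructs honest SIGNED values and the complex
observable on the bonds, and proves its s-holomorphicity (CHI15 Prop. 2.4 = CHI21 Lemma 2.12) in the
tree's own language `projLine (cornerLine …)` of `FermionicObservable.lean`/`SHolomorphicPrimitive.lean`:

* **The sign rule** (`kcSigma`, `kcS`): `S_B(v,T) = (-1)^{L(v,T) + ∑_{b∈B} L(b,T)} · X_B(v,T)`, `L(x,T)`
  the number of bonds of `T` on the leftward horizontal ray from `x` (`leftCount`; CHI15 §3.2 uses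
  such a ray as the branch cut `L_a`). **Gauge invariance** (`kcS_symmDiff_edgeBoundary`,
  `KCGaugeEquiv.kcS_eq`): `S(v, T ∆ ∂S) = S(v, T)` for `S ⊆ Λ` — the ray meets `∂S` an odd number of
  times iff `v ∈ S` (`leftCount_edgeBoundary_mod_two`), which compensates exactly the sign of the
  gauge move (CHI21 Lemma 2.6). So `S` is a function of the corner.
* **The signed toggle relations** at `β_c` (`kcS_toggle_horizontal_left/right`,
  `kcS_toggle_vertical_bottom/top`): across a horizontal bond `{v, v+e₀}`,
  `S(v, T∆h) = (-1)^r (√2 S(v,T) - S(v+e₀,T))`, `S(v+e₀, T∆h) = -(-1)^r (√2 S(v+e₀,T) - S(v,T))`,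
  `r = #{b ∈ B : h on the ray of b}`; across a vertical bond `{v, v+e₁}`,
  `S(v, T∆e) = √2 S(v,T) - κ S(v+e₁,T)` and symmetrically, with the **toggle sign**
  `κ = ε (-1)^{L(v,T)+L(v+e₁,T)}` (`vToggleSign`), which for the cut of a dual walk from `p₀` to `q`
  is `(-1)^{[p₀ ∈ U] + [q ∈ U]}`, `U` the half-strip left of the bond (`vToggleSign_crossSet`, by the
  crossing parity of its three-sided boundary, `even_crossings_leftStrip_iff`).
* **The observable on the bonds** (`kcObsH v` on `{v, v+e₀}`, `kcObsV x` on `{x, x+e₁}`): the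
  complex number (`kcVec` of `IsingDisorderFermion`) whose projections onto the corner lines are the
  signed corner values with the corner signs `rowSign` (upper corners), `hLowSign`, `vLowSign`
  (lower corners) — CHI15 Def. 2.3 / CHI21 Remark 2.11.
* **s-holomorphicity** (`projLine_kcObs_NE/NW/SW/SE`): at every corner whose two bonds carry cuts
  related by an admissible step, the projections of the observable on the two bonds onto the line of
  the corner coincide — at the upper corners `NE`, `NW` always, at the lower corners `SW`, `SE`
  whenever the two sign conventions agree there (hypotheses `hLowSign = vLowSign`). Where they
  disagree the projections are opposite: this is the sheet change of the spinor along the seam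
  emanating from the source corner (CHI15 Lemma 3.2 and §3.2: "`F` is not s-holomorphic at
  `a + δ/2`"; the seam is the tree's substitute for the branch cut `L_a`) and at the background spins.

* **The packaged observable** `kcObs : MedialVertex → ℂ` (`kcObsH` on east bonds, `kcObsV` on
  north bonds) and `IsSHolAt (kcObs …) (y, k)` for `k = 0, 1` (always) and `k = 2, 3` (off the seam):
  `isSHolAt_kcObs_zero/one/two/three` — the tree's own s-holomorphicity predicate of
  `SHolomorphicPrimitive.lean`, so that `cornerFlux`, `cornerFlux_cycle`, Remark 3.7 and Lemma 3.8
  there apply to the spin-Ising fermion verbatim.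

* **The seam of a cut system issued from the source plaquette `p₀`** (`IsKCCuts.gaugeEquiv_crossSet`,
  `vLowSign_eq_of_source`): along any usable dual walk the cuts follow the crossed bonds up to gauge,
  so with `cut p₀ = ∅` the lower-corner sign is `vLowSign x = -(-1)^{[p₀ ∈ U(x)]} g₀(x₁)`; the seam
  (where `hLowSign ≠ vLowSign`) is therefore the half-row of lower corners to the right of the top-right
  corner of `p₀` — the source corner `(p₀ + e₀ + e₁, SW)` and onwards — together with the rightward
  half-rows issued from the background spins: the tree's form of "multiplicative monodromy `-1`
  around `a` and each `a_j`" (CHI15 Prop. 2.4) and of the cut `L_a`.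

Everything is proved; no named facts. NOT here: the boundary condition (2.4) at frozen bonds.

## References

* D. Chelkak, C. Hongler, K. Izyurov, Ann. of Math. 181 (2015) 1087–1138 = arXiv:1202.2838: Def. 2.1,
  Def. 2.3, Prop. 2.4, Lemma 3.2, §3.2 — `ChelkakHonglerIzyurovAnnals2015`.
* D. Chelkak, C. Hongler, K. Izyurov, arXiv:2103.10263 (2021): §2.2, Lemmas 2.4, 2.6, 2.12,
  Remark 2.11 — `ChelkakHonglerIzyurov2021`.
-/

noncomputable section

open MeasureTheory Finset

namespace Literature.Probability.LatticeModels

/-! ## Leftward rays: the reference paths of the sign rule -/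

section Rays

open SimpleGraph

/-- The bond `b` lies **on the leftward ray from the site `v`**: it is a horizontal bond
`{x, x + e₀}` in the row of `v`, entirely to the left of `v` (`x 0 < v 0`). The leftward ray is the
reference path of the sign rule turning Kadanoff–Ceva corner values into a section of the double
cover (the branch cut `L_a = {a - x, x ≥ 0}` of Chelkak–Hongler–Izyurov 2015, §3.2, is such a ray).
[cite: ChelkakHonglerIzyurovAnnals2015, §3.2 (the slit L_a)] -/
def OnLeftRay (v : Site 2) (b : Sym2 (Site 2)) : Prop :=
  ∃ x : Site 2, b = s(x, x + cornerUnit 0) ∧ x 1 = v 1 ∧ x 0 < v 0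

open scoped Classical in
/-- **The number of bonds of `T` on the leftward ray from `v`** (finite since `T` is). Its parity
is the exponent of the sign rule. [cite: ChelkakHonglerIzyurovAnnals2015, §3.2] -/
def leftCount (v : Site 2) (T : Finset (Sym2 (Site 2))) : ℕ := #(T.filter fun b => OnLeftRay v b)

/-- A site of `ℤ²` is determined by its two coordinates. [folklore] -/
private theorem site2_eq_iff' (a b : Site 2) : a = b ↔ a 0 = b 0 ∧ a 1 = b 1 := by
  rw [funext_iff, Fin.forall_fin_two]

/-- Which bonds at a site lie on the leftward ray of `v`: the bond `{x, x + e_k}` is on the ray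
iff it is horizontal, in the row of `v`, with its left endpoint strictly left of `v`. [folklore] -/
theorem onLeftRay_mk_add_cornerUnit_iff (v x : Site 2) (k : Fin 4) :
    OnLeftRay v s(x, x + cornerUnit k) ↔
      (k = 0 ∧ x 1 = v 1 ∧ x 0 < v 0) ∨ (k = 2 ∧ x 1 = v 1 ∧ x 0 ≤ v 0) := by
  constructor
  · rintro ⟨y, hy, hy1, hy0⟩
    rw [Sym2.eq_iff] at hy
    simp only [site2_eq_iff', Pi.add_apply] at hy
    fin_cases k <;> simp [cornerUnit] at hy ⊢ <;> omega
  · rintro (⟨rfl, h1, h0⟩ | ⟨rfl, h1, h0⟩)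
    · exact ⟨x, rfl, h1, h0⟩
    · refine ⟨x + cornerUnit 2, ?_, by simpa [cornerUnit] using h1, by simp [cornerUnit]; omega⟩
      rw [add_assoc, show cornerUnit 2 + cornerUnit 0 = 0 by decide, add_zero, Sym2.eq_swap]

/-- Cardinality is additive mod `2` under symmetric difference. [folklore] -/
theorem card_symmDiff_mod_two {α : Type*} [DecidableEq α] (A B : Finset α) :
    #(symmDiff A B) % 2 = (#A + #B) % 2 := by
  have h1 : symmDiff A B = (A \ B) ∪ (B \ A) := rfl
  have hd : Disjoint (A \ B) (B \ A) :=
    Finset.disjoint_left.2 fun x hx hx' => (Finset.mem_sdiff.1 hx').2 (Finset.mem_sdiff.1 hx).1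
  rw [h1, Finset.card_union_of_disjoint hd]
  have hA := Finset.card_sdiff_add_card_inter A B
  have hB := Finset.card_sdiff_add_card_inter B A
  rw [Finset.inter_comm] at hB
  omega

open scoped Classical in
/-- Filtering commutes with symmetric difference. [folklore] -/
theorem filter_symmDiff' {α : Type*} [DecidableEq α] (p : α → Prop) (A B : Finset α) :
    (symmDiff A B).filter p = symmDiff (A.filter p) (B.filter p) := by
  ext x
  simp only [Finset.mem_filter, Finset.mem_symmDiff]
  tauto

open scoped Classical in
/-- `leftCount` is additive mod `2` under symmetric difference. [folklore] -/
theorem leftCount_symmDiff_mod_two (v : Site 2) (T T' : Finset (Sym2 (Site 2))) :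
    leftCount v (symmDiff T T') % 2 = (leftCount v T + leftCount v T') % 2 := by
  unfold leftCount
  rw [filter_symmDiff', card_symmDiff_mod_two]

open scoped Classical in
/-- The leftward ray of `v` meets the edge boundary of the singleton `{x}` in an odd number of bonds
iff `x = v` (one bond if `x = v`, two or none otherwise). [folklore] -/
theorem leftCount_edgeBoundary_singleton_mod_two (v x : Site 2) :
    leftCount v (edgeBoundary (zdGraph 2) {x}) % 2 = (if x = v then 1 else 0) := by
  -- the boundary of `{x}` consists of the four bonds at `x`
  have hbd : edgeBoundary (zdGraph 2) {x} = Finset.univ.image fun k : Fin 4 => s(x, x + cornerUnit k) := by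
    ext b
    induction b using Sym2.ind with
    | _ a c =>
      rw [mk_mem_edgeBoundary_iff, Finset.mem_image]
      simp only [Finset.mem_singleton, Finset.mem_univ, true_and]
      constructor
      · rintro ⟨hadj, hac⟩
        by_cases ha : a = x
        · subst ha
          obtain ⟨k, rfl⟩ := exists_eq_add_cornerUnit hadj
          exact ⟨k, rfl⟩
        · have hc : c = x := by by_contra hc; exact ha (hac.2 hc)
          subst hc
          obtain ⟨k, rfl⟩ := exists_eq_add_cornerUnit hadj.symm
          exact ⟨k, Sym2.eq_swap⟩
      · rintro ⟨k, hk⟩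
        rw [Sym2.eq_iff] at hk
        have hne : ¬ x + cornerUnit k = x := fun h' => cornerUnit_ne_zero k (by simpa using h')
        rcases hk with ⟨rfl, rfl⟩ | ⟨rfl, rfl⟩
        · exact ⟨cSrc_mem_edgeSet (x, k), ⟨fun _ => hne, fun _ => rfl⟩⟩
        · exact ⟨((SimpleGraph.mem_edgeSet _).1 (cSrc_mem_edgeSet (x, k))).symm,
            ⟨fun h => absurd h hne, fun h => absurd rfl h⟩⟩
  have hinj : Function.Injective fun k : Fin 4 => s(x, x + cornerUnit k) := by
    intro j k hjk
    simp only [Sym2.eq_iff] at hjk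
    rcases hjk with ⟨-, h2⟩ | ⟨h1, -⟩
    · exact cornerUnit_injective (add_left_cancel h2)
    · exact absurd h1.symm (fun h' => cornerUnit_ne_zero k (by simpa using h'))
  unfold leftCount
  rw [hbd, Finset.filter_image, Finset.card_image_of_injective _ hinj]
  simp only [onLeftRay_mk_add_cornerUnit_iff]
  -- count the directions `k` whose bond is on the ray
  by_cases hx : x = v
  · subst hx
    rw [if_pos rfl]
    have : (Finset.univ.filter fun k : Fin 4 =>
        (k = 0 ∧ x 1 = x 1 ∧ x 0 < x 0) ∨ (k = 2 ∧ x 1 = x 1 ∧ x 0 ≤ x 0)) = {2} := by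
      ext k; fin_cases k <;> simp
    rw [this]; rfl
  · rw [if_neg hx]
    by_cases hrow : x 1 = v 1 ∧ x 0 < v 0
    · have : (Finset.univ.filter fun k : Fin 4 =>
          (k = 0 ∧ x 1 = v 1 ∧ x 0 < v 0) ∨ (k = 2 ∧ x 1 = v 1 ∧ x 0 ≤ v 0)) = {0, 2} := by
        ext k; fin_cases k <;> simp [hrow.1, hrow.2, le_of_lt hrow.2]
      rw [this]; rfl
    · have hnot2 : ¬ (x 1 = v 1 ∧ x 0 ≤ v 0) := by
        rintro ⟨h1, h0⟩
        rcases lt_or_eq_of_le h0 with h0 | h0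
        · exact hrow ⟨h1, h0⟩
        · exact hx ((site2_eq_iff' x v).2 ⟨h0, h1⟩)
      have : (Finset.univ.filter fun k : Fin 4 =>
          (k = 0 ∧ x 1 = v 1 ∧ x 0 < v 0) ∨ (k = 2 ∧ x 1 = v 1 ∧ x 0 ≤ v 0)) = ∅ := by
        ext k; fin_cases k <;> simp [hrow, hnot2]
      rw [this]; rfl

open scoped Classical in
/-- **Gauge invariance of the sign rule**: the leftward ray from `v` meets the edge boundary of a
finite set `S` of sites in an odd number of bonds iff `v ∈ S` (by additivity under symmetric
difference, from the singleton case). Hence the sign `(-1)^{leftCount v T}` attached to the corner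
value `X(v, T)` compensates exactly the sign `(-1)^{[v ∈ S]}` of the gauge move `T ↦ T ∆ ∂S`
(Chelkak–Hongler–Izyurov 2021, Lemma 2.6: the sign "every time `v` winds around a disorder").
[cite: ChelkakHonglerIzyurov2021, Lemmas 2.4 and 2.6] -/
theorem leftCount_edgeBoundary_mod_two (v : Site 2) (S : Finset (Site 2)) :
    leftCount v (edgeBoundary (zdGraph 2) S) % 2 = (if v ∈ S then 1 else 0) := by
  induction S using Finset.induction_on with
  | empty =>
    have : edgeBoundary (zdGraph 2) (∅ : Finset (Site 2)) = ∅ := by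
      ext b; simp [edgeBoundary, edgesTouching]
    rw [this]; simp [leftCount]
  | insert x S hx ih =>
    have hins : insert x S = symmDiff S {x} := by
      ext y; simp only [Finset.mem_insert, Finset.mem_symmDiff, Finset.mem_singleton]
      constructor
      · rintro (rfl | hy)
        · exact Or.inr ⟨rfl, hx⟩
        · exact Or.inl ⟨hy, fun h => hx (h ▸ hy)⟩
      · rintro (⟨hy, -⟩ | ⟨rfl, -⟩)
        · exact Or.inr hy
        · exact Or.inl rfl
    rw [hins, edgeBoundary_symmDiff, leftCount_symmDiff_mod_two, Nat.add_mod,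
      leftCount_edgeBoundary_singleton_mod_two, ih]
    rw [← hins]
    by_cases hv : v ∈ S <;> by_cases hxv : x = v
    · subst hxv; exact absurd hv hx
    · simp [hv, hxv, Finset.mem_insert, Ne.symm hxv]
    · subst hxv; simp [hv]
    · simp [hv, hxv, Finset.mem_insert, Ne.symm hxv]

open scoped Classical in
/-- For the cut of a plaquette walk, the parity of `leftCount` is the parity of the number of steps
crossing a bond of the ray. [folklore] -/
theorem leftCount_crossSet_mod_two (v : Site 2) :
    ∀ {p q : Site 2} (W : (zdGraph 2).Walk p q),
      leftCount v (crossSet W) % 2 = (W.darts.countP fun d => decide (OnLeftRay v (plaqBond d.fst d.snd))) % 2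
  | _, _, Walk.nil => by simp [crossSet, leftCount]
  | u, _, Walk.cons (v := w) h W => by
    have ih := leftCount_crossSet_mod_two v W
    rw [crossSet, leftCount_symmDiff_mod_two, Walk.darts_cons, List.countP_cons, Nat.add_mod, ih]
    have h1 : leftCount v {plaqBond u w} = if OnLeftRay v (plaqBond u w) then 1 else 0 := by
      unfold leftCount; rw [Finset.filter_singleton]; split_ifs <;> rfl
    rw [h1]
    by_cases hr : OnLeftRay v (plaqBond u w) <;> simp [hr]

/-- The **half-strip** of plaquettes between the rows of the sites `v` and `v + e₁` (plaquette
labels `q` with `q 1 = v 1`) strictly to the left of the vertical bond `{v, v + e₁}` (`q 0 < v 0`):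
its boundary bonds are that bond, the leftward ray from `v` and the leftward ray from `v + e₁`.
[folklore] -/
def leftStrip (v : Site 2) : Set (Site 2) := {q | q 1 = v 1 ∧ q 0 < v 0}

/-- **The dual steps leaving the half-strip are exactly those crossing its three-sided boundary**:
the vertical bond `{v, v + e₁}`, the leftward ray from `v` (bottom) and the leftward ray from
`v + e₁` (top). [folklore] -/
theorem dartCrosses_leftStrip_iff (v : Site 2) (d : (zdGraph 2).Dart) :
    DartCrosses (leftStrip v) d ↔
      plaqBond d.fst d.snd = s(v, v + cornerUnit 1) ∨ OnLeftRay v (plaqBond d.fst d.snd) ∨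
        OnLeftRay (v + cornerUnit 1) (plaqBond d.fst d.snd) := by
  obtain ⟨k, hk⟩ := dart_snd_eq d
  rw [hk, plaqBond_add_cornerUnit, onLeftRay_mk_add_cornerUnit_iff, onLeftRay_mk_add_cornerUnit_iff, Sym2.eq_iff]
  simp only [DartCrosses, leftStrip, Set.mem_setOf_eq, hk, site2_eq_iff', Pi.add_apply]
  fin_cases k <;> simp [cornerUnit, cornerOff] <;> omega

open scoped Classical in
/-- **Parity of the crossings of the three-sided boundary of the half-strip**: along a plaquette
walk from `p` to `q`, the number of steps across `{v, v + e₁}`, plus those across the leftward ray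
from `v`, plus those across the leftward ray from `v + e₁`, is even iff `p` and `q` lie on the same
side of the half-strip. [folklore] -/
theorem even_crossings_leftStrip_iff (v : Site 2) {p q : Site 2} (W : (zdGraph 2).Walk p q) :
    Even (W.darts.countP fun d => decide (plaqBond d.fst d.snd = s(v, v + cornerUnit 1) ∨
        OnLeftRay v (plaqBond d.fst d.snd) ∨ OnLeftRay (v + cornerUnit 1) (plaqBond d.fst d.snd))) ↔
      (p ∈ leftStrip v ↔ q ∈ leftStrip v) := by
  rw [← even_countP_dartCrosses_iff (leftStrip v) W]
  have : (W.darts.countP fun d => decide (plaqBond d.fst d.snd = s(v, v + cornerUnit 1) ∨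
      OnLeftRay v (plaqBond d.fst d.snd) ∨ OnLeftRay (v + cornerUnit 1) (plaqBond d.fst d.snd))) =
      W.darts.countP fun d => decide (DartCrosses (leftStrip v) d) :=
    List.countP_congr fun d _ => by simp only [decide_eq_true_eq, dartCrosses_leftStrip_iff]
  rw [this]

end Rays

/-! ## Signed Kadanoff–Ceva corner values: the sign rule -/

section Signed

open SimpleGraph

variable {V₀ : Type*}
variable (G₂ : SimpleGraph (Site 2)) [G₂.LocallyFinite]

/-- **The sign of the sign rule** at the site `v` for the cut `T` and background spins `B`:
`(-1)^{L(v,T) + ∑_{b ∈ B} L(b,T)}`, `L(x, T)` the number of bonds of `T` on the leftward ray from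
`x`. [cite: ChelkakHonglerIzyurovAnnals2015, §3.2; ChelkakHonglerIzyurov2021, Lemma 2.6] -/
def kcSigma (B : Finset (Site 2)) (v : Site 2) (T : Finset (Sym2 (Site 2))) : ℝ :=
  (-1) ^ (leftCount v T + ∑ b ∈ B, leftCount b T)

/-- `kcSigma` is `±1`. [folklore] -/
theorem kcSigma_mul_self (B : Finset (Site 2)) (v : Site 2) (T : Finset (Sym2 (Site 2))) :
    kcSigma B v T * kcSigma B v T = 1 := by
  rw [kcSigma, ← pow_add, ← two_mul, pow_mul, neg_one_sq, one_pow]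

/-- **The signed corner value** `S_B(v, T) = (-1)^{L(v,T) + ∑_b L(b,T)} · ⟨μ_T σ_v σ_B⟩` — the
real value, at the corner of the site `v` and the plaquette where the cut `T` ends, of a genuine
section of the spinor observable (Chelkak–Hongler–Izyurov 2015, Def. 2.1 / Prop. 2.4), up to the
eighth root of unity of the corner type. [cite: ChelkakHonglerIzyurovAnnals2015, Def. 2.1 and Prop. 2.4] -/
def kcS (Λ : Finset (Site 2)) (β : ℝ) (bc : BoundaryCondition (Site 2)) (B : Finset (Site 2))
    (T : Finset (Sym2 (Site 2))) (v : Site 2) : ℝ :=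
  kcSigma B v T * kcCorner G₂ Λ β bc B T v

/-- Powers of `-1` only see parities. [folklore] -/
theorem neg_one_pow_eq_of_mod_two_eq {m n : ℕ} (h : m % 2 = n % 2) : ((-1 : ℝ) ^ m) = (-1) ^ n := by
  rw [← Nat.div_add_mod m 2, ← Nat.div_add_mod n 2, pow_add, pow_add, pow_mul, pow_mul, h]
  norm_num

/-- The sign rule under a symmetric difference of cuts is multiplicative. [folklore] -/
theorem kcSigma_symmDiff (B : Finset (Site 2)) (v : Site 2) (T T' : Finset (Sym2 (Site 2))) :
    kcSigma B v (symmDiff T T') = kcSigma B v T * kcSigma B v T' := by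
  rw [kcSigma, kcSigma, kcSigma, ← pow_add]
  apply neg_one_pow_eq_of_mod_two_eq
  rw [Nat.add_mod, leftCount_symmDiff_mod_two, Finset.sum_nat_mod, Finset.sum_congr rfl
    (fun b _ => leftCount_symmDiff_mod_two b T T'), ← Finset.sum_nat_mod, Finset.sum_add_distrib]
  omega

/-- **The sign rule detects the gauge move**: `kcSigma B v (∂S) = (-1)^{[v ∈ S] + #(B ∩ S)}`.
[cite: ChelkakHonglerIzyurov2021, Lemma 2.6] -/
theorem kcSigma_edgeBoundary (B : Finset (Site 2)) (v : Site 2) (S : Finset (Site 2)) :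
    kcSigma B v (edgeBoundary (zdGraph 2) S) = (-1) ^ ((if v ∈ S then 1 else 0) + #(B ∩ S)) := by
  rw [kcSigma]
  apply neg_one_pow_eq_of_mod_two_eq
  rw [Nat.add_mod, leftCount_edgeBoundary_mod_two, Finset.sum_nat_mod,
    Finset.sum_congr rfl (fun b _ => leftCount_edgeBoundary_mod_two b S), Finset.sum_boole, Nat.cast_id,
    Finset.filter_mem_eq_inter]
  split_ifs <;> omega

/-- Parity bookkeeping of the gauge sign of a corner value:
`#((B ∆ {v}) ∩ S) ≡ #(B ∩ S) + [v ∈ S]`. [folklore] -/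
theorem card_symmDiff_singleton_inter_mod_two (B S : Finset (Site 2)) (v : Site 2) :
    #(symmDiff B {v} ∩ S) % 2 = (#(B ∩ S) + if v ∈ S then 1 else 0) % 2 := by
  have h1 : symmDiff B {v} ∩ S = symmDiff (B ∩ S) ({v} ∩ S) := by
    ext x; simp only [Finset.mem_inter, Finset.mem_symmDiff, Finset.mem_singleton]; tauto
  rw [h1, card_symmDiff_mod_two]
  congr 1
  by_cases hv : v ∈ S
  · rw [if_pos hv, Finset.singleton_inter_of_mem hv, Finset.card_singleton]
  · rw [if_neg hv, Finset.singleton_inter_of_notMem hv, Finset.card_empty]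

/-- **Gauge invariance of the signed corner values**: for `S ⊆ Λ` (free sites, all four of whose
bonds are edges of the domain graph, itself a subgraph of `ℤ²`) and a cut `T` of interacting
bonds, `S_B(v, T ∆ ∂S) = S_B(v, T)` — the sign of the gauge move (`(-1)^{[v∈S]+#(B∩S)}`,
`kcCorner_symmDiff_edgeBoundary`) is exactly compensated by the sign rule
(`kcSigma_edgeBoundary`). Hence the signed value depends only on the plaquette, not on the branch
cut chosen to reach it: it is a function on corners (Chelkak–Hongler–Izyurov 2021, §2.2: "there is
a natural way to extend this choice as the points move around"). [cite: ChelkakHonglerIzyurov2021, §2.2 and Lemma 2.6] -/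
theorem kcS_symmDiff_edgeBoundary {Λ S : Finset (Site 2)} (hS : S ⊆ Λ)
    (hG : ∀ v ∈ Λ, ∀ k : Fin 4, G₂.Adj v (v + cornerUnit k)) (hle : G₂ ≤ zdGraph 2)
    (β : ℝ) (η : SpinConfig (Site 2)) (B : Finset (Site 2)) {T : Finset (Sym2 (Site 2))}
    (hT : T ⊆ edgesTouching G₂ Λ) (v : Site 2) :
    kcS G₂ Λ β (.fixed η) B (symmDiff T (edgeBoundary G₂ S)) v = kcS G₂ Λ β (.fixed η) B T v := by
  rw [kcS, kcS, kcCorner_symmDiff_edgeBoundary G₂ hS β η B hT v, edgeBoundary_eq_of_subset G₂ hG hle hS,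
    kcSigma_symmDiff, kcSigma_edgeBoundary]
  have hpar : ((-1 : ℝ) ^ #(symmDiff B {v} ∩ S)) = (-1) ^ ((if v ∈ S then 1 else 0) + #(B ∩ S)) := by
    apply neg_one_pow_eq_of_mod_two_eq
    rw [card_symmDiff_singleton_inter_mod_two, add_comm]
  rw [hpar, mul_assoc, ← mul_assoc ((-1 : ℝ) ^ _) ((-1) ^ _), ← pow_add, ← two_mul, pow_mul, neg_one_sq, one_pow,
    one_mul]

/-- Gauge-equivalent cuts have the same signed corner values. [cite: ChelkakHonglerIzyurov2021, §2.2] -/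
theorem KCGaugeEquiv.kcS_eq {Λ : Finset (Site 2)} (hG : ∀ v ∈ Λ, ∀ k : Fin 4, G₂.Adj v (v + cornerUnit k))
    (hle : G₂ ≤ zdGraph 2) {T T' : Finset (Sym2 (Site 2))} (h : KCGaugeEquiv G₂ Λ T T')
    (hT : T ⊆ edgesTouching G₂ Λ) (β : ℝ) (η : SpinConfig (Site 2)) (B : Finset (Site 2)) (v : Site 2) :
    kcS G₂ Λ β (.fixed η) B T' v = kcS G₂ Λ β (.fixed η) B T v := by
  obtain ⟨S, hS, rfl⟩ := h
  exact kcS_symmDiff_edgeBoundary G₂ hS hG hle β η B hT v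

/-! ### The signed toggle relations -/

/-- The sign rule under toggling one bond: `kcSigma B v (T ∆ {e}) = θ · kcSigma B v T` with
`θ = (-1)^{[e on the ray of v] + #{b ∈ B : e on the ray of b}}`. [folklore] -/
theorem kcSigma_symmDiff_singleton (B : Finset (Site 2)) (v : Site 2) (T : Finset (Sym2 (Site 2))) (e : Sym2 (Site 2)) :
    kcSigma B v (symmDiff T {e}) = kcSigma B v T * kcSigma B v {e} :=
  kcSigma_symmDiff B v T {e}

open scoped Classical in
/-- The sign of a single bond: `kcSigma B v {e} = (-1)^{[OnLeftRay v e] + #{b ∈ B | OnLeftRay b e}}`. [folklore] -/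
theorem kcSigma_singleton (B : Finset (Site 2)) (v : Site 2) (e : Sym2 (Site 2)) :
    kcSigma B v {e} = (-1) ^ ((if OnLeftRay v e then 1 else 0) + #(B.filter fun b => OnLeftRay b e)) := by
  rw [kcSigma]
  congr 1
  have h1 : ∀ x : Site 2, leftCount x {e} = if OnLeftRay x e then 1 else 0 := by
    intro x; unfold leftCount; rw [Finset.filter_singleton]; split_ifs <;> rfl
  simp only [h1, Finset.sum_boole, Nat.cast_id]

/-- **The signed toggle relation, general form** (critical `β`): across the bond `e = {v, v'}`,
`S(v, T ∆ {e}) = σ_v({e}) (√2 S(v,T) - μ S(v',T))` with the explicit sign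
`μ = ε · σ_v(T) σ_{v'}(T)`, `ε = kcSign T e`; the `B`-parts of the two sign rules cancel in `μ`.
[cite: ChelkakHonglerIzyurov2021, Lemma 2.12; ChelkakHonglerIzyurovAnnals2015, Prop. 2.4] -/
theorem kcS_symmDiff_singleton (Λ : Finset (Site 2)) (bc : BoundaryCondition (Site 2)) (B : Finset (Site 2))
    (T : Finset (Sym2 (Site 2))) (v v' : Site 2) :
    kcS G₂ Λ criticalBetaTwo bc B (symmDiff T {s(v, v')}) v =
      kcSigma B v {s(v, v')} * (Real.sqrt 2 * kcS G₂ Λ criticalBetaTwo bc B T v -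
        (kcSign T s(v, v') * kcSigma B v T * kcSigma B v' T) * kcS G₂ Λ criticalBetaTwo bc B T v') := by
  rw [kcS, kcS, kcS, kcCorner_symmDiff_singleton_critical G₂ Λ bc B T v v', kcSigma_symmDiff_singleton]
  have h := kcSigma_mul_self B v' T
  linear_combination (kcSigma B v T * kcSigma B v {s(v, v')} * kcSign T s(v, v') *
    kcCorner G₂ Λ criticalBetaTwo bc B T v') * h

/-- Moving one step to the right adds the bond in between to the leftward ray:
`L(v + e₀, T) = L(v, T) + [{v, v + e₀} ∈ T]`. [folklore] -/
theorem leftCount_add_cornerUnit_zero (v : Site 2) (T : Finset (Sym2 (Site 2))) :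
    leftCount (v + cornerUnit 0) T = leftCount v T + if s(v, v + cornerUnit 0) ∈ T then 1 else 0 := by
  classical
  unfold leftCount
  have key : ∀ b : Sym2 (Site 2), OnLeftRay (v + cornerUnit 0) b ↔ OnLeftRay v b ∨ b = s(v, v + cornerUnit 0) := by
    intro b
    constructor
    · rintro ⟨x, rfl, h1, h0⟩
      simp only [Pi.add_apply, cornerUnit] at h1 h0
      simp only [Pi.single_eq_same, Pi.single_eq_of_ne (show (1 : Fin 2) ≠ 0 by decide), add_zero] at h1 h0
      by_cases hx0 : x 0 < v 0
      · exact Or.inl ⟨x, rfl, h1, hx0⟩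
      · right
        have hx : x = v := by
          rw [funext_iff, Fin.forall_fin_two]; exact ⟨by omega, h1⟩
        rw [hx]
    · rintro (⟨x, rfl, h1, h0⟩ | rfl)
      · refine ⟨x, rfl, ?_, ?_⟩ <;> simp [Pi.add_apply, cornerUnit] <;> omega
      · refine ⟨v, rfl, ?_, ?_⟩ <;> simp [Pi.add_apply, cornerUnit]
  have hnot : ¬ OnLeftRay v s(v, v + cornerUnit 0) := by
    rintro ⟨x, hx, h1, h0⟩
    rw [Sym2.eq_iff] at hx
    rcases hx with ⟨h, -⟩ | ⟨h, h'⟩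
    · rw [← h] at h0; exact lt_irrefl _ h0
    · have := congrFun h' 0
      have h2 := congrFun h 0
      simp [Pi.add_apply, cornerUnit] at this h2
      omega
  rw [Finset.filter_congr (fun b _ => key b), Finset.filter_or, Finset.card_union_of_disjoint]
  · congr 1
    rw [Finset.filter_eq']
    split_ifs <;> rfl
  · rw [Finset.disjoint_left]
    intro b hb hb'
    rw [Finset.mem_filter] at hb hb'
    exact hnot (hb'.2 ▸ hb.2)

/-- A vertical bond lies on no leftward ray. [folklore] -/
theorem not_onLeftRay_vertical (x v : Site 2) : ¬ OnLeftRay x s(v, v + cornerUnit 1) := by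
  rintro ⟨y, hy, -, -⟩
  rw [Sym2.eq_iff] at hy
  rcases hy with ⟨h, h'⟩ | ⟨h, h'⟩
  · rw [← h] at h'
    have := congrFun h' 1
    simp [Pi.add_apply, cornerUnit] at this
  · have h1 := congrFun h 1
    have h2 := congrFun h' 1
    simp [Pi.add_apply, cornerUnit] at h1 h2
    omega

/-- The bond to the right of `v` is not on the leftward ray of `v`, but is on that of `v + e₀`.
[folklore] -/
theorem onLeftRay_self_iff (v : Site 2) :
    ¬ OnLeftRay v s(v, v + cornerUnit 0) ∧ OnLeftRay (v + cornerUnit 0) s(v, v + cornerUnit 0) := by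
  constructor
  · rintro ⟨x, hx, h1, h0⟩
    rw [Sym2.eq_iff] at hx
    rcases hx with ⟨h, -⟩ | ⟨h, h'⟩
    · rw [← h] at h0; exact lt_irrefl _ h0
    · have := congrFun h' 0
      have h2 := congrFun h 0
      simp [Pi.add_apply, cornerUnit] at this h2
      omega
  · exact ⟨v, rfl, by simp [Pi.add_apply, cornerUnit], by simp [Pi.add_apply, cornerUnit]⟩

open scoped Classical in
/-- The number of background spins whose leftward ray contains the bond `e`. [folklore] -/
def rayCountB (B : Finset (Site 2)) (e : Sym2 (Site 2)) : ℕ := #(B.filter fun b => OnLeftRay b e)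

/-- **Signed toggle relation across a horizontal bond, left endpoint**:
`S(v, T ∆ {v, v+e₀}) = (-1)^{rayCountB} (√2 S(v,T) - S(v + e₀, T))`. [cite: ChelkakHonglerIzyurovAnnals2015, Prop. 2.4] -/
theorem kcS_toggle_horizontal_left (Λ : Finset (Site 2)) (bc : BoundaryCondition (Site 2)) (B : Finset (Site 2))
    (T : Finset (Sym2 (Site 2))) (v : Site 2) :
    kcS G₂ Λ criticalBetaTwo bc B (symmDiff T {s(v, v + cornerUnit 0)}) v =
      (-1) ^ rayCountB B s(v, v + cornerUnit 0) *
        (Real.sqrt 2 * kcS G₂ Λ criticalBetaTwo bc B T v - kcS G₂ Λ criticalBetaTwo bc B T (v + cornerUnit 0)) := by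
  rw [kcS_symmDiff_singleton, kcSigma_singleton, if_neg (onLeftRay_self_iff v).1, zero_add]
  have hμ : kcSign T s(v, v + cornerUnit 0) * kcSigma B v T * kcSigma B (v + cornerUnit 0) T = 1 := by
    rw [kcSigma, kcSigma, leftCount_add_cornerUnit_zero, mul_assoc, ← pow_add, kcSign]
    split_ifs with he
    · rw [show leftCount v T + ∑ b ∈ B, leftCount b T + (leftCount v T + 1 + ∑ b ∈ B, leftCount b T) =
          2 * (leftCount v T + ∑ b ∈ B, leftCount b T) + 1 by ring, pow_succ, pow_mul, neg_one_sq, one_pow]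
      norm_num
    · rw [add_zero, ← two_mul, pow_mul, neg_one_sq, one_pow, one_mul]
  rw [hμ, one_mul]
  rfl

/-- **Signed toggle relation across a horizontal bond, right endpoint**:
`S(v + e₀, T ∆ {v, v+e₀}) = -(-1)^{rayCountB} (√2 S(v+e₀,T) - S(v, T))`. [cite: ChelkakHonglerIzyurovAnnals2015, Prop. 2.4] -/
theorem kcS_toggle_horizontal_right (Λ : Finset (Site 2)) (bc : BoundaryCondition (Site 2)) (B : Finset (Site 2))
    (T : Finset (Sym2 (Site 2))) (v : Site 2) :
    kcS G₂ Λ criticalBetaTwo bc B (symmDiff T {s(v, v + cornerUnit 0)}) (v + cornerUnit 0) =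
      -(-1) ^ rayCountB B s(v, v + cornerUnit 0) *
        (Real.sqrt 2 * kcS G₂ Λ criticalBetaTwo bc B T (v + cornerUnit 0) - kcS G₂ Λ criticalBetaTwo bc B T v) := by
  have h := kcS_symmDiff_singleton G₂ Λ bc B T (v + cornerUnit 0) v
  rw [Sym2.eq_swap] at h
  rw [h, kcSigma_singleton, if_pos (onLeftRay_self_iff v).2, pow_add, pow_one]
  have hμ : kcSign T s(v, v + cornerUnit 0) * kcSigma B (v + cornerUnit 0) T * kcSigma B v T = 1 := by
    rw [kcSigma, kcSigma, leftCount_add_cornerUnit_zero, mul_assoc, ← pow_add, kcSign]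
    split_ifs with he
    · rw [show leftCount v T + 1 + ∑ b ∈ B, leftCount b T + (leftCount v T + ∑ b ∈ B, leftCount b T) =
          2 * (leftCount v T + ∑ b ∈ B, leftCount b T) + 1 by ring, pow_succ, pow_mul, neg_one_sq, one_pow]
      norm_num
    · rw [add_zero, ← two_mul, pow_mul, neg_one_sq, one_pow, one_mul]
  rw [hμ, one_mul]
  simp only [rayCountB]
  ring

/-- **The toggle sign across a vertical bond** `{v, v + e₁}` for the cut `T`:
`κ = ε · (-1)^{L(v,T) + L(v+e₁,T)}` — the parity of the cut along the three-sided boundary of the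
half-strip (the bond itself and the two leftward rays). [folklore] -/
def vToggleSign (T : Finset (Sym2 (Site 2))) (v : Site 2) : ℝ :=
  kcSign T s(v, v + cornerUnit 1) * (-1) ^ (leftCount v T + leftCount (v + cornerUnit 1) T)

/-- `vToggleSign² = 1`. [folklore] -/
theorem vToggleSign_mul_self (T : Finset (Sym2 (Site 2))) (v : Site 2) : vToggleSign T v * vToggleSign T v = 1 := by
  rw [vToggleSign, mul_mul_mul_comm, kcSign_mul_self, one_mul, ← pow_add, ← two_mul, pow_mul, neg_one_sq, one_pow]

/-- **Signed toggle relation across a vertical bond, lower endpoint**: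
`S(v, T ∆ {v, v+e₁}) = √2 S(v,T) - κ S(v + e₁, T)`. [cite: ChelkakHonglerIzyurovAnnals2015, Prop. 2.4] -/
theorem kcS_toggle_vertical_bottom (Λ : Finset (Site 2)) (bc : BoundaryCondition (Site 2)) (B : Finset (Site 2))
    (T : Finset (Sym2 (Site 2))) (v : Site 2) :
    kcS G₂ Λ criticalBetaTwo bc B (symmDiff T {s(v, v + cornerUnit 1)}) v =
      Real.sqrt 2 * kcS G₂ Λ criticalBetaTwo bc B T v - vToggleSign T v * kcS G₂ Λ criticalBetaTwo bc B T (v + cornerUnit 1) := by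
  classical
  rw [kcS_symmDiff_singleton, kcSigma_singleton, if_neg (not_onLeftRay_vertical v v)]
  have h0 : #(B.filter fun b => OnLeftRay b s(v, v + cornerUnit 1)) = 0 := by
    rw [Finset.card_eq_zero, Finset.filter_eq_empty_iff]; exact fun b _ => not_onLeftRay_vertical b v
  rw [h0, add_zero, pow_zero, one_mul]
  congr 2
  rw [vToggleSign, kcSigma, kcSigma, mul_assoc, ← pow_add]
  congr 1
  apply neg_one_pow_eq_of_mod_two_eq
  omega

/-- **Signed toggle relation across a vertical bond, upper endpoint**:
`S(v + e₁, T ∆ {v, v+e₁}) = √2 S(v+e₁,T) - κ S(v, T)`. [cite: ChelkakHonglerIzyurovAnnals2015, Prop. 2.4] -/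
theorem kcS_toggle_vertical_top (Λ : Finset (Site 2)) (bc : BoundaryCondition (Site 2)) (B : Finset (Site 2))
    (T : Finset (Sym2 (Site 2))) (v : Site 2) :
    kcS G₂ Λ criticalBetaTwo bc B (symmDiff T {s(v, v + cornerUnit 1)}) (v + cornerUnit 1) =
      Real.sqrt 2 * kcS G₂ Λ criticalBetaTwo bc B T (v + cornerUnit 1) - vToggleSign T v * kcS G₂ Λ criticalBetaTwo bc B T v := by
  classical
  have h := kcS_symmDiff_singleton G₂ Λ bc B T (v + cornerUnit 1) v
  rw [Sym2.eq_swap] at h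
  rw [h, kcSigma_singleton, if_neg (not_onLeftRay_vertical _ v)]
  have h0 : #(B.filter fun b => OnLeftRay b s(v, v + cornerUnit 1)) = 0 := by
    rw [Finset.card_eq_zero, Finset.filter_eq_empty_iff]; exact fun b _ => not_onLeftRay_vertical b v
  rw [h0, add_zero, pow_zero, one_mul]
  congr 2
  rw [vToggleSign, kcSigma, kcSigma, mul_assoc, ← pow_add]
  congr 1
  apply neg_one_pow_eq_of_mod_two_eq
  omega

open scoped Classical in
/-- **The toggle sign of the cut of a plaquette walk** from `p₀` to `q` across the vertical bond
`{v, v + e₁}`: `κ = (-1)^{[p₀ ∈ U] + [q ∈ U]}`, `U` the half-strip left of the bond — since `κ`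
is the parity of the crossings of its three-sided boundary (`even_crossings_leftStrip_iff`).
[folklore] -/
theorem vToggleSign_crossSet {p₀ q : Site 2} (W : (zdGraph 2).Walk p₀ q) (v : Site 2) :
    vToggleSign (crossSet W) v =
      (-1) ^ ((if p₀ ∈ leftStrip v then 1 else 0) + (if q ∈ leftStrip v then 1 else 0)) := by
  have hsign : kcSign (crossSet W) s(v, v + cornerUnit 1) =
      (-1) ^ (W.darts.countP fun d => decide (plaqBond d.fst d.snd = s(v, v + cornerUnit 1))) := by
    rw [kcSign]
    have hm := mem_crossSet_iff s(v, v + cornerUnit 1) W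
    split_ifs with he
    · exact (Odd.neg_one_pow (hm.1 he)).symm
    · rw [Even.neg_one_pow (Nat.not_odd_iff_even.1 (fun h => he (hm.2 h)))]
  rw [vToggleSign, hsign, ← pow_add]
  apply neg_one_pow_eq_of_mod_two_eq
  have h1 := leftCount_crossSet_mod_two v W
  have h2 := leftCount_crossSet_mod_two (v + cornerUnit 1) W
  -- the three disjoint boundary predicates
  have hd1 : ∀ d : (zdGraph 2).Dart, ¬ (OnLeftRay v (plaqBond d.fst d.snd) ∧
      OnLeftRay (v + cornerUnit 1) (plaqBond d.fst d.snd)) := by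
    rintro d ⟨⟨x, hx, hx1, -⟩, ⟨y, hy, hy1, -⟩⟩
    rw [hx, Sym2.eq_iff] at hy
    have : x = y := by
      rcases hy with ⟨h, -⟩ | ⟨h, h'⟩; · exact h
      · exfalso; have := congrFun h 0; have h2 := congrFun h' 0; simp [Pi.add_apply, cornerUnit] at this h2; omega
    subst this
    simp [Pi.add_apply, cornerUnit] at hy1 hx1; omega
  have hd2 : ∀ d : (zdGraph 2).Dart, ¬ (plaqBond d.fst d.snd = s(v, v + cornerUnit 1) ∧
      (OnLeftRay v (plaqBond d.fst d.snd) ∨ OnLeftRay (v + cornerUnit 1) (plaqBond d.fst d.snd))) := by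
    rintro d ⟨h1, h2 | h2⟩ <;> rw [h1] at h2
    · exact not_onLeftRay_vertical v v h2
    · exact not_onLeftRay_vertical _ v h2
  have hsum : ∀ l : List ((zdGraph 2).Dart),
      (l.countP fun d => decide (plaqBond d.fst d.snd = s(v, v + cornerUnit 1))) +
        ((l.countP fun d => decide (OnLeftRay v (plaqBond d.fst d.snd))) +
          l.countP fun d => decide (OnLeftRay (v + cornerUnit 1) (plaqBond d.fst d.snd))) =
      l.countP fun d => decide (plaqBond d.fst d.snd = s(v, v + cornerUnit 1) ∨
        OnLeftRay v (plaqBond d.fst d.snd) ∨ OnLeftRay (v + cornerUnit 1) (plaqBond d.fst d.snd)) := by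
    intro l
    induction l with
    | nil => simp
    | cons d l ih =>
      simp only [List.countP_cons]
      by_cases ha : plaqBond d.fst d.snd = s(v, v + cornerUnit 1)
      · have hb : ¬ OnLeftRay v (plaqBond d.fst d.snd) := fun hb => hd2 d ⟨ha, Or.inl hb⟩
        have hc : ¬ OnLeftRay (v + cornerUnit 1) (plaqBond d.fst d.snd) := fun hc => hd2 d ⟨ha, Or.inr hc⟩
        rw [decide_eq_true ha, decide_eq_false hb, decide_eq_false hc, decide_eq_true (Or.inl ha)]
        simp only [if_true, Bool.false_eq_true, if_false]
        omega
      · by_cases hb : OnLeftRay v (plaqBond d.fst d.snd)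
        · have hc : ¬ OnLeftRay (v + cornerUnit 1) (plaqBond d.fst d.snd) := fun hc => hd1 d ⟨hb, hc⟩
          rw [decide_eq_false ha, decide_eq_true hb, decide_eq_false hc, decide_eq_true (Or.inr (Or.inl hb))]
          simp only [if_true, Bool.false_eq_true, if_false]
          omega
        · by_cases hc : OnLeftRay (v + cornerUnit 1) (plaqBond d.fst d.snd)
          · rw [decide_eq_false ha, decide_eq_false hb, decide_eq_true hc, decide_eq_true (Or.inr (Or.inr hc))]
            simp only [if_true, Bool.false_eq_true, if_false]
            omega
          · have hn : ¬ (plaqBond d.fst d.snd = s(v, v + cornerUnit 1) ∨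
                OnLeftRay v (plaqBond d.fst d.snd) ∨ OnLeftRay (v + cornerUnit 1) (plaqBond d.fst d.snd)) := by
              rintro (h | h | h); · exact ha h
              · exact hb h
              · exact hc h
            rw [decide_eq_false ha, decide_eq_false hb, decide_eq_false hc, decide_eq_false hn]
            simp only [Bool.false_eq_true, if_false]
            omega
  have hsumW := hsum W.darts
  have hpar := even_crossings_leftStrip_iff v W
  by_cases hp : p₀ ∈ leftStrip v <;> by_cases hq : q ∈ leftStrip v <;>
    simp only [hp, hq, if_true, if_false, iff_true, iff_false, not_true] at hpar ⊢
  · have := Nat.even_iff.1 hpar; omega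
  · have := Nat.odd_iff.1 (Nat.not_even_iff_odd.1 hpar); omega
  · have := Nat.odd_iff.1 (Nat.not_even_iff_odd.1 hpar); omega
  · have := Nat.even_iff.1 hpar; omega

end Signed

/-! ## The signed observable on the bonds and its s-holomorphicity -/

section Observable

open Complex ComplexConjugate SimpleGraph

variable (G₂ : SimpleGraph (Site 2)) [G₂.LocallyFinite]

/-- `N_{n+1} = √2 N_n` for the frame lengths. [folklore] -/
theorem frameNorm_succ (v₀ : Site 2) (n : ℕ) : frameNorm v₀ (n + 1) = Real.sqrt 2 * frameNorm v₀ n := by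
  rw [frameNorm, frameNorm, pow_succ, ← mul_assoc, norm_mul]
  have : ‖(1 : ℂ) - I‖ = Real.sqrt 2 := by
    rw [Complex.norm_def, normSq_apply]; norm_num
  rw [this, mul_comm]

/-- `(1 + i)⁴ = -4`. [folklore] -/
theorem one_add_I_pow_four : (1 + I) ^ 4 = -4 := by
  rw [show (4 : ℕ) = 2 * 2 by rfl, pow_mul, one_add_I_sq, mul_pow, I_sq]; ring

/-- `Re` of the frame coordinate of `kcVec 0 0 a d` at index `4` (the corner line `0` read after a
full turn of the frame): `-4 a N_0`. [folklore] -/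
theorem re_frameCoord_kcVec_four (v₀ : Site 2) (a d : ℝ) :
    (frameCoord v₀ (kcVec v₀ 0 a d) * (1 + I) ^ 4).re = -4 * a * frameNorm v₀ 0 := by
  have h := frameCoord_kcVec_mul_pow v₀ 0 4 a d
  rw [zero_add] at h
  rw [h, one_add_I_pow_four]; simp; ring


/-- Clean-exponent forms of the frame coordinates of `kcVec v₀ 0 a d` (horizontal bonds):
indices `1, 2, 3`. [folklore] -/
theorem re_frameCoord_kcVecH (v₀ : Site 2) (a d : ℝ) :
    (frameCoord v₀ (kcVec v₀ 0 a d) * (1 + I) ^ 1).re = (a + d) * frameNorm v₀ 0 ∧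
      (frameCoord v₀ (kcVec v₀ 0 a d) * (1 + I) ^ 2).re = 2 * d * frameNorm v₀ 0 ∧
        (frameCoord v₀ (kcVec v₀ 0 a d) * (1 + I) ^ 3).re = -2 * (a - d) * frameNorm v₀ 0 := by
  refine ⟨?_, ?_, ?_⟩
  · have h := re_frameCoord_kcVec_one v₀ 0 a d; rwa [zero_add] at h
  · have h := re_frameCoord_kcVec_two v₀ 0 a d; rwa [zero_add] at h
  · have h := re_frameCoord_kcVec_three v₀ 0 a d; rwa [zero_add] at h

/-- Clean-exponent forms of the frame coordinates of `kcVec v₀ 1 a d` (vertical bonds): indices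
`1, 2, 3, 4`. [folklore] -/
theorem re_frameCoord_kcVecV (v₀ : Site 2) (a d : ℝ) :
    (frameCoord v₀ (kcVec v₀ 1 a d) * (1 + I) ^ 1).re = a * frameNorm v₀ 1 ∧
      (frameCoord v₀ (kcVec v₀ 1 a d) * (1 + I) ^ 2).re = (a + d) * frameNorm v₀ 1 ∧
        (frameCoord v₀ (kcVec v₀ 1 a d) * (1 + I) ^ 3).re = 2 * d * frameNorm v₀ 1 ∧
          (frameCoord v₀ (kcVec v₀ 1 a d) * (1 + I) ^ 4).re = -2 * (a - d) * frameNorm v₀ 1 :=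
  ⟨re_frameCoord_kcVec_zero v₀ 1 a d, re_frameCoord_kcVec_one v₀ 1 a d, re_frameCoord_kcVec_two v₀ 1 a d,
    re_frameCoord_kcVec_three v₀ 1 a d⟩

/-- **The row sign** `g₀(r) = (-1)^{#{b ∈ B : b₁ ≤ r}}` of the sign convention (for `B = ∅` it is
`1`): the upper corners of the sites of row `r` carry the sign `g₀(r)`. [folklore] -/
def rowSign (B : Finset (Site 2)) (r : ℤ) : ℝ := (-1) ^ #(B.filter fun b => b 1 ≤ r)

/-- `rowSign² = 1`. [folklore] -/
theorem rowSign_mul_self (B : Finset (Site 2)) (r : ℤ) : rowSign B r * rowSign B r = 1 := by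
  rw [rowSign, ← pow_add, ← two_mul, pow_mul, neg_one_sq, one_pow]

variable (Λ : Finset (Site 2)) (η : SpinConfig (Site 2)) (B : Finset (Site 2)) (cut : Site 2 → Finset (Sym2 (Site 2)))

/-- **The sign of the lower corners of a horizontal bond** `{v, v + e₀}` (corners `(v, SE)` and
`(v + e₀, SW)`, in the plaquette below the bond): `-(-1)^{rayCountB} g₀(v₁)`. [folklore] -/
def hLowSign (v : Site 2) : ℝ := -(-1) ^ rayCountB B s(v, v + cornerUnit 0) * rowSign B (v 1)

/-- **The sign of the lower corners at the upper endpoint of a vertical bond** `{x, x + e₁}`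
(corners `(x + e₁, SW)` and `(x + e₁, SE)`): `κ g₀(x₁)`, `κ` the toggle sign of the cut of the
plaquette on the left of the bond. [folklore] -/
def vLowSign (x : Site 2) : ℝ := vToggleSign (cut (faceAt x 1)) x * rowSign B (x 1)

/-- **The observable on the horizontal bond** `{v, v + e₀}`: the complex number whose projections
onto the lines of the corners `(v, NE)` and `(v + e₀, SW)` are the signed corner values with the
signs `g₀(v₁)` and `hLowSign v` (the plaquette above the bond has the cut `cut (faceAt v 0)`, the one
below `cut (faceAt v 3)`). [cite: ChelkakHonglerIzyurovAnnals2015, Def. 2.1 and Def. 2.3; ChelkakHonglerIzyurov2021, Remark 2.11] -/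
def kcObsH (v : Site 2) : ℂ :=
  kcVec 0 0 (rowSign B (v 1) * kcS G₂ Λ criticalBetaTwo (.fixed η) B (cut (faceAt v 0)) v)
    (hLowSign B v * kcS G₂ Λ criticalBetaTwo (.fixed η) B (cut (faceAt v 3)) (v + cornerUnit 0))

/-- **The observable on the vertical bond** `{x, x + e₁}`: projections onto the lines of the corners
`(x, NW)` and `(x + e₁, SE)` are the signed corner values with the signs `g₀(x₁)` and `vLowSign x`
(left plaquette `faceAt x 1`, right plaquette `faceAt x 0`). [cite: ChelkakHonglerIzyurovAnnals2015, Def. 2.1 and Def. 2.3; ChelkakHonglerIzyurov2021, Remark 2.11] -/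
def kcObsV (x : Site 2) : ℂ :=
  kcVec 0 1 (rowSign B (x 1) * kcS G₂ Λ criticalBetaTwo (.fixed η) B (cut (faceAt x 1)) x)
    (vLowSign B cut x * kcS G₂ Λ criticalBetaTwo (.fixed η) B (cut (faceAt x 0)) (x + cornerUnit 1))

variable {Λ η B cut}

/-- **s-holomorphicity at the corner `(y, NE)`** (always): the projections of the observable on the
east bond `{y, y+e₀}` and on the north bond `{y, y+e₁}` onto the line of the corner `(y, 0)`
coincide, as soon as the cuts of the plaquettes `faceAt y 1` (NW) and `faceAt y 0` (NE) are related
by the admissible step across the north bond. (Chelkak–Hongler–Izyurov 2015, Prop. 2.4; the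
computation is the propagation identity.) [cite: ChelkakHonglerIzyurovAnnals2015, Prop. 2.4; ChelkakHonglerIzyurov2021, Lemma 2.12] -/
theorem projLine_kcObs_NE (hG : ∀ v ∈ Λ, ∀ k : Fin 4, G₂.Adj v (v + cornerUnit k)) (hle : G₂ ≤ zdGraph 2)
    {y : Site 2} (hT : cut (faceAt y 1) ⊆ edgesTouching G₂ Λ) (he : s(y, y + cornerUnit 1) ∈ edgesTouching G₂ Λ)
    (hstep : KCGaugeEquiv G₂ Λ (symmDiff (cut (faceAt y 1)) {s(y, y + cornerUnit 1)}) (cut (faceAt y 0))) :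
    projLine (cornerLine y (faceAt y 0)) (kcObsH G₂ Λ η B cut y) =
      projLine (cornerLine y (faceAt y 0)) (kcObsV G₂ Λ η B cut y) := by
  rw [projLine_cornerLine_eq_iff 0 y 0 (n := 4) (by norm_num), kcObsH, kcObsV, re_frameCoord_kcVec_four,
    re_frameCoord_kcVec_three]
  -- the values at the NE plaquette through the toggle across the north bond
  have hsub := symmDiff_singleton_subset_edgesTouching G₂ hT he
  have e1 : kcS G₂ Λ criticalBetaTwo (.fixed η) B (cut (faceAt y 0)) y =
      Real.sqrt 2 * kcS G₂ Λ criticalBetaTwo (.fixed η) B (cut (faceAt y 1)) y -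
        vToggleSign (cut (faceAt y 1)) y * kcS G₂ Λ criticalBetaTwo (.fixed η) B (cut (faceAt y 1)) (y + cornerUnit 1) := by
    rw [hstep.kcS_eq G₂ hG hle hsub, kcS_toggle_vertical_bottom]
  have e2 : kcS G₂ Λ criticalBetaTwo (.fixed η) B (cut (faceAt y 0)) (y + cornerUnit 1) =
      Real.sqrt 2 * kcS G₂ Λ criticalBetaTwo (.fixed η) B (cut (faceAt y 1)) (y + cornerUnit 1) -
        vToggleSign (cut (faceAt y 1)) y * kcS G₂ Λ criticalBetaTwo (.fixed η) B (cut (faceAt y 1)) y := by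
    rw [hstep.kcS_eq G₂ hG hle hsub, kcS_toggle_vertical_top]
  rw [e1, vLowSign, e2, frameNorm_succ]
  have hκ := vToggleSign_mul_self (cut (faceAt y 1)) y
  have hs : Real.sqrt 2 ^ 2 = 2 := Real.sq_sqrt zero_le_two
  linear_combination (2 * rowSign B (y 1) * kcS G₂ Λ criticalBetaTwo (.fixed η) B (cut (faceAt y 1)) y *
      frameNorm 0 0 * Real.sqrt 2) * hκ -
    (2 * rowSign B (y 1) * frameNorm 0 0 * vToggleSign (cut (faceAt y 1)) y *
      kcS G₂ Λ criticalBetaTwo (.fixed η) B (cut (faceAt y 1)) (y + cornerUnit 1)) * hs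

/-- Lattice bookkeeping at the corner `(y, NW)`/`(y, SW)`: the horizontal bond west of `y` starts at
`y + cornerUnit 2 = y - e₀`. [folklore] -/
theorem westSite_facts (y : Site 2) :
    y + cornerUnit 2 + cornerUnit 0 = y ∧ faceAt (y + cornerUnit 2) 0 = faceAt y 1 ∧
      faceAt (y + cornerUnit 2) 3 = faceAt y 2 ∧ (y + cornerUnit 2) 1 = y 1 := by
  have h0 : y + cornerUnit 2 + cornerUnit 0 = y := by
    rw [add_assoc, show cornerUnit 2 + cornerUnit 0 = 0 by decide, add_zero]
  refine ⟨h0, ?_, ?_, by simp [cornerUnit]⟩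
  · have := faceAt_add_unit_succ (y + cornerUnit 2) 0
    rw [h0] at this; exact this.symm
  · have := faceAt_add_unit_add_two (y + cornerUnit 2) 0
    rw [h0] at this; exact this.symm

/-- Lattice bookkeeping at the corners `(y, SW)`/`(y, SE)`: the vertical bond south of `y` starts at
`y + cornerUnit 3 = y - e₁`. [folklore] -/
theorem southSite_facts (y : Site 2) :
    y + cornerUnit 3 + cornerUnit 1 = y ∧ faceAt (y + cornerUnit 3) 1 = faceAt y 2 ∧
      faceAt (y + cornerUnit 3) 0 = faceAt y 3 ∧ (y + cornerUnit 3) 1 = y 1 - 1 := by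
  have h0 : y + cornerUnit 3 + cornerUnit 1 = y := by
    rw [add_assoc, show cornerUnit 3 + cornerUnit 1 = 0 by decide, add_zero]
  refine ⟨h0, ?_, ?_, by simp [cornerUnit]; ring⟩
  · have := faceAt_add_unit_succ (y + cornerUnit 3) 1
    rw [h0] at this; exact this.symm
  · have h1 : faceAt (y + cornerUnit 3 + cornerUnit 1) ((1 : Fin 4) + 2) = faceAt (y + cornerUnit 3) ((1 : Fin 4) + 3) :=
      faceAt_add_unit_add_two (y + cornerUnit 3) 1
    rw [h0] at h1
    exact h1.symm

/-- `((-1)^n)² = 1` in `ℝ`. [folklore] -/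
theorem neg_one_pow_mul_self' (n : ℕ) : ((-1 : ℝ) ^ n) * (-1) ^ n = 1 := by
  rw [← pow_add, ← two_mul, pow_mul, neg_one_sq, one_pow]

/-- **s-holomorphicity at the corner `(y, NW)`** (always): the projections of the observable on
the north bond `{y, y+e₁}` and on the west bond `{y-e₀, y}` onto the line of the corner `(y, 1)`
coincide, given the admissible step across the west bond between the plaquettes `faceAt y 1` (NW,
above) and `faceAt y 2` (SW, below). [cite: ChelkakHonglerIzyurovAnnals2015, Prop. 2.4; ChelkakHonglerIzyurov2021, Lemma 2.12] -/
theorem projLine_kcObs_NW (hG : ∀ v ∈ Λ, ∀ k : Fin 4, G₂.Adj v (v + cornerUnit k)) (hle : G₂ ≤ zdGraph 2)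
    {y : Site 2} (hT : cut (faceAt y 1) ⊆ edgesTouching G₂ Λ)
    (he : s(y + cornerUnit 2, y + cornerUnit 2 + cornerUnit 0) ∈ edgesTouching G₂ Λ)
    (hstep : KCGaugeEquiv G₂ Λ (symmDiff (cut (faceAt y 1)) {s(y + cornerUnit 2, y + cornerUnit 2 + cornerUnit 0)})
      (cut (faceAt y 2))) :
    projLine (cornerLine y (faceAt y 1)) (kcObsV G₂ Λ η B cut y) =
      projLine (cornerLine y (faceAt y 1)) (kcObsH G₂ Λ η B cut (y + cornerUnit 2)) := by
  obtain ⟨h0, hf0, hf3, hy1⟩ := westSite_facts y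
  rw [projLine_cornerLine_eq_iff 0 y 1 (n := 1) (by norm_num), kcObsH, kcObsV, (re_frameCoord_kcVecV 0 _ _).1,
    (re_frameCoord_kcVecH 0 _ _).1, hf0, hf3, hy1, frameNorm_succ]
  have hsub := symmDiff_singleton_subset_edgesTouching G₂ hT he
  have e1 : kcS G₂ Λ criticalBetaTwo (.fixed η) B (cut (faceAt y 2)) (y + cornerUnit 2 + cornerUnit 0) =
      -(-1) ^ rayCountB B s(y + cornerUnit 2, y + cornerUnit 2 + cornerUnit 0) *
        (Real.sqrt 2 * kcS G₂ Λ criticalBetaTwo (.fixed η) B (cut (faceAt y 1)) (y + cornerUnit 2 + cornerUnit 0) -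
          kcS G₂ Λ criticalBetaTwo (.fixed η) B (cut (faceAt y 1)) (y + cornerUnit 2)) := by
    rw [hstep.kcS_eq G₂ hG hle hsub, kcS_toggle_horizontal_right]
  rw [e1, hLowSign, h0, hy1]
  have hρ := neg_one_pow_mul_self' (rayCountB B s(y + cornerUnit 2, y))
  linear_combination (-(rowSign B (y 1) * (Real.sqrt 2 * kcS G₂ Λ criticalBetaTwo (.fixed η) B (cut (faceAt y 1)) y -
    kcS G₂ Λ criticalBetaTwo (.fixed η) B (cut (faceAt y 1)) (y + cornerUnit 2)) * frameNorm 0 0)) * hρ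

/-- **s-holomorphicity at the corner `(y, SW)` off the seam**: the projections of the observable on
the west bond `{y-e₀, y}` and on the south bond `{y-e₁, y}` onto the line of the corner `(y, 2)`
coincide, given the admissible step across the south bond between `faceAt y 2` (SW, left) and
`faceAt y 3` (SE, right), PROVIDED the two sign conventions agree at this corner
(`hLowSign (y - e₀) = vLowSign (y - e₁)`); where they disagree — along the seam emanating from the
source, and at the background spins — the two projections are opposite (the sheet change of the
spinor). [cite: ChelkakHonglerIzyurovAnnals2015, Prop. 2.4; ChelkakHonglerIzyurov2021, Lemma 2.12] -/
theorem projLine_kcObs_SW (hG : ∀ v ∈ Λ, ∀ k : Fin 4, G₂.Adj v (v + cornerUnit k)) (hle : G₂ ≤ zdGraph 2)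
    {y : Site 2} (hT : cut (faceAt y 2) ⊆ edgesTouching G₂ Λ)
    (he : s(y + cornerUnit 3, y + cornerUnit 3 + cornerUnit 1) ∈ edgesTouching G₂ Λ)
    (hstep : KCGaugeEquiv G₂ Λ (symmDiff (cut (faceAt y 2)) {s(y + cornerUnit 3, y + cornerUnit 3 + cornerUnit 1)})
      (cut (faceAt y 3)))
    (hsign : hLowSign B (y + cornerUnit 2) = vLowSign B cut (y + cornerUnit 3)) :
    projLine (cornerLine y (faceAt y 2)) (kcObsH G₂ Λ η B cut (y + cornerUnit 2)) =
      projLine (cornerLine y (faceAt y 2)) (kcObsV G₂ Λ η B cut (y + cornerUnit 3)) := by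
  obtain ⟨w0, wf0, wf3, wy1⟩ := westSite_facts y
  obtain ⟨s0, sf1, sf0, sy1⟩ := southSite_facts y
  rw [projLine_cornerLine_eq_iff 0 y 2 (n := 2) (by norm_num), kcObsH, kcObsV, (re_frameCoord_kcVecH 0 _ _).2.1,
    (re_frameCoord_kcVecV 0 _ _).2.1, wf3, w0, sf1, sf0, s0, sy1, frameNorm_succ, hsign, vLowSign, sf1]
  have hsub := symmDiff_singleton_subset_edgesTouching G₂ hT he
  have e1 : kcS G₂ Λ criticalBetaTwo (.fixed η) B (cut (faceAt y 3)) (y + cornerUnit 3 + cornerUnit 1) =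
      Real.sqrt 2 * kcS G₂ Λ criticalBetaTwo (.fixed η) B (cut (faceAt y 2)) (y + cornerUnit 3 + cornerUnit 1) -
        vToggleSign (cut (faceAt y 2)) (y + cornerUnit 3) * kcS G₂ Λ criticalBetaTwo (.fixed η) B (cut (faceAt y 2)) (y + cornerUnit 3) := by
    rw [hstep.kcS_eq G₂ hG hle hsub, kcS_toggle_vertical_top]
  rw [s0] at e1
  rw [e1, sy1]
  have hκ := vToggleSign_mul_self (cut (faceAt y 2)) (y + cornerUnit 3)
  have hs : Real.sqrt 2 ^ 2 = 2 := Real.sq_sqrt zero_le_two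
  linear_combination (rowSign B (y 1 - 1) * kcS G₂ Λ criticalBetaTwo (.fixed η) B (cut (faceAt y 2)) (y + cornerUnit 3) *
    (Real.sqrt 2 * frameNorm 0 0)) * hκ -
    (vToggleSign (cut (faceAt y 2)) (y + cornerUnit 3) * rowSign B (y 1 - 1) *
      kcS G₂ Λ criticalBetaTwo (.fixed η) B (cut (faceAt y 2)) y * frameNorm 0 0) * hs

/-- **s-holomorphicity at the corner `(y, SE)` off the seam**: the projections of the observable on
the south bond `{y-e₁, y}` and on the east bond `{y, y+e₀}` onto the line of the corner `(y, 3)`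
coincide, given the admissible step across the east bond between `faceAt y 0` (NE, above) and
`faceAt y 3` (SE, below), provided `vLowSign (y - e₁) = hLowSign y`. [cite: ChelkakHonglerIzyurovAnnals2015, Prop. 2.4; ChelkakHonglerIzyurov2021, Lemma 2.12] -/
theorem projLine_kcObs_SE (hG : ∀ v ∈ Λ, ∀ k : Fin 4, G₂.Adj v (v + cornerUnit k)) (hle : G₂ ≤ zdGraph 2)
    {y : Site 2} (hT : cut (faceAt y 0) ⊆ edgesTouching G₂ Λ)
    (he : s(y, y + cornerUnit 0) ∈ edgesTouching G₂ Λ)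
    (hstep : KCGaugeEquiv G₂ Λ (symmDiff (cut (faceAt y 0)) {s(y, y + cornerUnit 0)}) (cut (faceAt y 3)))
    (hsign : vLowSign B cut (y + cornerUnit 3) = hLowSign B y) :
    projLine (cornerLine y (faceAt y 3)) (kcObsV G₂ Λ η B cut (y + cornerUnit 3)) =
      projLine (cornerLine y (faceAt y 3)) (kcObsH G₂ Λ η B cut y) := by
  obtain ⟨s0, sf1, sf0, sy1⟩ := southSite_facts y
  rw [projLine_cornerLine_eq_iff 0 y 3 (n := 3) (by norm_num), kcObsH, kcObsV, (re_frameCoord_kcVecV 0 _ _).2.2.1,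
    (re_frameCoord_kcVecH 0 _ _).2.2, sf0, s0, frameNorm_succ, hsign, hLowSign]
  have hsub := symmDiff_singleton_subset_edgesTouching G₂ hT he
  have e1 : kcS G₂ Λ criticalBetaTwo (.fixed η) B (cut (faceAt y 3)) y =
      (-1) ^ rayCountB B s(y, y + cornerUnit 0) *
        (Real.sqrt 2 * kcS G₂ Λ criticalBetaTwo (.fixed η) B (cut (faceAt y 0)) y -
          kcS G₂ Λ criticalBetaTwo (.fixed η) B (cut (faceAt y 0)) (y + cornerUnit 0)) := by
    rw [hstep.kcS_eq G₂ hG hle hsub, kcS_toggle_horizontal_left]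
  have e2 : kcS G₂ Λ criticalBetaTwo (.fixed η) B (cut (faceAt y 3)) (y + cornerUnit 0) =
      -(-1) ^ rayCountB B s(y, y + cornerUnit 0) *
        (Real.sqrt 2 * kcS G₂ Λ criticalBetaTwo (.fixed η) B (cut (faceAt y 0)) (y + cornerUnit 0) -
          kcS G₂ Λ criticalBetaTwo (.fixed η) B (cut (faceAt y 0)) y) := by
    rw [hstep.kcS_eq G₂ hG hle hsub, kcS_toggle_horizontal_right]
  rw [e1, e2]
  have hρ := neg_one_pow_mul_self' (rayCountB B s(y, y + cornerUnit 0))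
  have hs : Real.sqrt 2 ^ 2 = 2 := Real.sq_sqrt zero_le_two
  linear_combination
    (-(2 * rowSign B (y 1) * frameNorm 0 0 * kcS G₂ Λ criticalBetaTwo (.fixed η) B (cut (faceAt y 0)) y)) * hρ +
    (-(2 * rowSign B (y 1) * frameNorm 0 0 * kcS G₂ Λ criticalBetaTwo (.fixed η) B (cut (faceAt y 0)) y *
      ((-1) ^ rayCountB B s(y, y + cornerUnit 0) * (-1) ^ rayCountB B s(y, y + cornerUnit 0)))) * hs

/-! ### The observable as one function on the medial vertices -/

/-- Injectivity of the east bond in its left endpoint. [folklore] -/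
theorem eastBond_injective {u v : Site 2} (h : s(u, u + cornerUnit 0) = s(v, v + cornerUnit 0)) : u = v := by
  rw [Sym2.eq_iff] at h
  rcases h with ⟨h1, -⟩ | ⟨h1, h2⟩
  · exact h1
  · exfalso
    have := congrFun h1 0; have h3 := congrFun h2 0
    simp [Pi.add_apply, cornerUnit] at this h3; omega

/-- Injectivity of the north bond in its lower endpoint. [folklore] -/
theorem northBond_injective {u v : Site 2} (h : s(u, u + cornerUnit 1) = s(v, v + cornerUnit 1)) : u = v := by
  rw [Sym2.eq_iff] at h
  rcases h with ⟨h1, -⟩ | ⟨h1, h2⟩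
  · exact h1
  · exfalso
    have := congrFun h1 1; have h3 := congrFun h2 1
    simp [Pi.add_apply, cornerUnit] at this h3; omega

/-- A north bond is not an east bond. [folklore] -/
theorem northBond_ne_eastBond (x v : Site 2) : s(x, x + cornerUnit 1) ≠ s(v, v + cornerUnit 0) := by
  intro h
  rw [Sym2.eq_iff] at h
  rcases h with ⟨h1, h2⟩ | ⟨h1, h2⟩
  · rw [h1] at h2; have := congrFun h2 0; simp [Pi.add_apply, cornerUnit] at this
  · have := congrFun h1 1; have h3 := congrFun h2 1
    simp [Pi.add_apply, cornerUnit] at this h3; omega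

variable (Λ η B cut) in
open scoped Classical in
/-- **The signed critical Kadanoff–Ceva observable on the medial vertices** (bonds): `kcObsH v` on
the east bonds `{v, v+e₀}`, `kcObsV x` on the north bonds `{x, x+e₁}` (every lattice bond is of
exactly one of these forms), junk `0` on non-bonds. [cite: ChelkakHonglerIzyurovAnnals2015, Def. 2.1 and Def. 2.3] -/
def kcObs (e : MedialVertex) : ℂ :=
  if h : ∃ v : Site 2, e = s(v, v + cornerUnit 0) then kcObsH G₂ Λ η B cut h.choose
  else if h' : ∃ x : Site 2, e = s(x, x + cornerUnit 1) then kcObsV G₂ Λ η B cut h'.choose else 0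

/-- The observable on an east bond. [folklore] -/
theorem kcObs_east (v : Site 2) : kcObs G₂ Λ η B cut s(v, v + cornerUnit 0) = kcObsH G₂ Λ η B cut v := by
  classical
  have h : ∃ u : Site 2, s(v, v + cornerUnit 0) = s(u, u + cornerUnit 0) := ⟨v, rfl⟩
  rw [kcObs, dif_pos h, eastBond_injective h.choose_spec.symm]

/-- The observable on a north bond. [folklore] -/
theorem kcObs_north (x : Site 2) : kcObs G₂ Λ η B cut s(x, x + cornerUnit 1) = kcObsV G₂ Λ η B cut x := by
  classical
  have h : ¬ ∃ u : Site 2, s(x, x + cornerUnit 1) = s(u, u + cornerUnit 0) := fun ⟨u, hu⟩ => northBond_ne_eastBond x u hu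
  have h' : ∃ u : Site 2, s(x, x + cornerUnit 1) = s(u, u + cornerUnit 1) := ⟨x, rfl⟩
  rw [kcObs, dif_neg h, dif_pos h', northBond_injective h'.choose_spec.symm]

/-- The west bond of `y` as an east bond: `{y, y + cornerUnit 2} = {y - e₀, (y - e₀) + e₀}`. [folklore] -/
theorem westBond_eq (y : Site 2) : s(y, y + cornerUnit 2) = s(y + cornerUnit 2, y + cornerUnit 2 + cornerUnit 0) := by
  rw [(westSite_facts y).1, Sym2.eq_swap]

/-- The south bond of `y` as a north bond: `{y, y + cornerUnit 3} = {y - e₁, (y - e₁) + e₁}`. [folklore] -/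
theorem southBond_eq (y : Site 2) : s(y, y + cornerUnit 3) = s(y + cornerUnit 3, y + cornerUnit 3 + cornerUnit 1) := by
  rw [(southSite_facts y).1, Sym2.eq_swap]

/-- **`IsSHolAt` at the corner `(y, 0)`** for the packaged observable. [cite: ChelkakHonglerIzyurovAnnals2015, Prop. 2.4] -/
theorem isSHolAt_kcObs_zero (hG : ∀ v ∈ Λ, ∀ k : Fin 4, G₂.Adj v (v + cornerUnit k)) (hle : G₂ ≤ zdGraph 2)
    {y : Site 2} (hT : cut (faceAt y 1) ⊆ edgesTouching G₂ Λ) (he : s(y, y + cornerUnit 1) ∈ edgesTouching G₂ Λ)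
    (hstep : KCGaugeEquiv G₂ Λ (symmDiff (cut (faceAt y 1)) {s(y, y + cornerUnit 1)}) (cut (faceAt y 0))) :
    IsSHolAt (kcObs G₂ Λ η B cut) (y, 0) := by
  show projLine (cornerLine y (cFace (y, 0))) (kcObs G₂ Λ η B cut (cSrc (y, 0))) =
    projLine (cornerLine y (cFace (y, 0))) (kcObs G₂ Λ η B cut (cTgt (y, 0)))
  simp only [cFace, cSrc, cTgt, show (0 : Fin 4) + 1 = 1 from rfl, kcObs_east, kcObs_north]
  exact projLine_kcObs_NE G₂ hG hle hT he hstep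

/-- **`IsSHolAt` at the corner `(y, 1)`**. [cite: ChelkakHonglerIzyurovAnnals2015, Prop. 2.4] -/
theorem isSHolAt_kcObs_one (hG : ∀ v ∈ Λ, ∀ k : Fin 4, G₂.Adj v (v + cornerUnit k)) (hle : G₂ ≤ zdGraph 2)
    {y : Site 2} (hT : cut (faceAt y 1) ⊆ edgesTouching G₂ Λ)
    (he : s(y + cornerUnit 2, y + cornerUnit 2 + cornerUnit 0) ∈ edgesTouching G₂ Λ)
    (hstep : KCGaugeEquiv G₂ Λ (symmDiff (cut (faceAt y 1)) {s(y + cornerUnit 2, y + cornerUnit 2 + cornerUnit 0)})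
      (cut (faceAt y 2))) :
    IsSHolAt (kcObs G₂ Λ η B cut) (y, 1) := by
  show projLine (cornerLine y (cFace (y, 1))) (kcObs G₂ Λ η B cut (cSrc (y, 1))) =
    projLine (cornerLine y (cFace (y, 1))) (kcObs G₂ Λ η B cut (cTgt (y, 1)))
  simp only [cFace, cSrc, cTgt, show (1 : Fin 4) + 1 = 2 from rfl, westBond_eq, kcObs_east, kcObs_north]
  exact projLine_kcObs_NW G₂ hG hle hT he hstep

/-- **`IsSHolAt` at the corner `(y, 2)`** off the seam. [cite: ChelkakHonglerIzyurovAnnals2015, Prop. 2.4] -/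
theorem isSHolAt_kcObs_two (hG : ∀ v ∈ Λ, ∀ k : Fin 4, G₂.Adj v (v + cornerUnit k)) (hle : G₂ ≤ zdGraph 2)
    {y : Site 2} (hT : cut (faceAt y 2) ⊆ edgesTouching G₂ Λ)
    (he : s(y + cornerUnit 3, y + cornerUnit 3 + cornerUnit 1) ∈ edgesTouching G₂ Λ)
    (hstep : KCGaugeEquiv G₂ Λ (symmDiff (cut (faceAt y 2)) {s(y + cornerUnit 3, y + cornerUnit 3 + cornerUnit 1)})
      (cut (faceAt y 3)))
    (hsign : hLowSign B (y + cornerUnit 2) = vLowSign B cut (y + cornerUnit 3)) :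
    IsSHolAt (kcObs G₂ Λ η B cut) (y, 2) := by
  show projLine (cornerLine y (cFace (y, 2))) (kcObs G₂ Λ η B cut (cSrc (y, 2))) =
    projLine (cornerLine y (cFace (y, 2))) (kcObs G₂ Λ η B cut (cTgt (y, 2)))
  simp only [cFace, cSrc, cTgt, show (2 : Fin 4) + 1 = 3 from rfl, westBond_eq, southBond_eq, kcObs_east, kcObs_north]
  exact projLine_kcObs_SW G₂ hG hle hT he hstep hsign

/-- **`IsSHolAt` at the corner `(y, 3)`** off the seam. [cite: ChelkakHonglerIzyurovAnnals2015, Prop. 2.4] -/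
theorem isSHolAt_kcObs_three (hG : ∀ v ∈ Λ, ∀ k : Fin 4, G₂.Adj v (v + cornerUnit k)) (hle : G₂ ≤ zdGraph 2)
    {y : Site 2} (hT : cut (faceAt y 0) ⊆ edgesTouching G₂ Λ) (he : s(y, y + cornerUnit 0) ∈ edgesTouching G₂ Λ)
    (hstep : KCGaugeEquiv G₂ Λ (symmDiff (cut (faceAt y 0)) {s(y, y + cornerUnit 0)}) (cut (faceAt y 3)))
    (hsign : vLowSign B cut (y + cornerUnit 3) = hLowSign B y) :
    IsSHolAt (kcObs G₂ Λ η B cut) (y, 3) := by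
  show projLine (cornerLine y (cFace (y, 3))) (kcObs G₂ Λ η B cut (cSrc (y, 3))) =
    projLine (cornerLine y (cFace (y, 3))) (kcObs G₂ Λ η B cut (cTgt (y, 3)))
  simp only [cFace, cSrc, cTgt, show (3 : Fin 4) + 1 = 0 from rfl, southBond_eq, kcObs_east, kcObs_north]
  exact projLine_kcObs_SE G₂ hG hle hT he hstep hsign

/-! ### The seam of a cut system issued from a source plaquette -/

/-- Gauge moves commute with any symmetric difference. [folklore] -/
theorem KCGaugeEquiv.symmDiff_right' {Λ : Finset (Site 2)} {T T' : Finset (Sym2 (Site 2))}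
    (h : KCGaugeEquiv G₂ Λ T T') (X : Finset (Sym2 (Site 2))) :
    KCGaugeEquiv G₂ Λ (symmDiff T X) (symmDiff T' X) := by
  obtain ⟨S, hS, rfl⟩ := h
  exact ⟨S, hS, symmDiff_right_comm _ _ _⟩

/-- **Along a usable dual walk the cuts follow the crossed bonds**: for an admissible cut system on a
set of plaquettes containing all plaquettes touching `Λ`, and a dual walk `W` from `p` to `q` crossing
only bonds touching `Λ`, `cut q ≈ cut p ∆ crossSet W` (gauge equivalence). [cite: ChelkakHonglerIzyurov2021, §2.2] -/
theorem IsKCCuts.gaugeEquiv_crossSet {Λ : Finset (Site 2)} {cut : Site 2 → Finset (Sym2 (Site 2))} {P : Set (Site 2)}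
    (h : IsKCCuts G₂ Λ cut P) (hP : ↑(touchPlaquettes Λ) ⊆ P) :
    ∀ {p q : Site 2} (W : (zdGraph 2).Walk p q), UsableWalk Λ W →
      KCGaugeEquiv G₂ Λ (symmDiff (cut p) (crossSet W)) (cut q)
  | p, _, Walk.nil, _ => by
    rw [crossSet, ← Finset.bot_eq_empty, symmDiff_bot]; exact KCGaugeEquiv.refl G₂ Λ _
  | p, q, Walk.cons (v := p₁) hadj W', hus => by
    have hus' : UsableWalk Λ W' := fun d hd => hus d (by rw [Walk.darts_cons]; exact List.mem_cons_of_mem _ hd)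
    have hfirst : ∃ x ∈ Λ, x ∈ plaqBond p p₁ := hus ⟨(p, p₁), hadj⟩ (by rw [Walk.darts_cons]; exact List.mem_cons_self)
    have ih := IsKCCuts.gaugeEquiv_crossSet h hP W' hus'
    obtain ⟨k, rfl⟩ := exists_eq_add_cornerUnit hadj
    -- the step of the cut system across the first crossed bond
    set u := p + cornerOff (k + 1) with hu
    have hf1 : faceAt u (k + 1) = p := faceAt_add_cornerOff p (k + 1)
    have hf2 : faceAt u (k + 1 + 3) = p + cornerUnit k := by
      rw [show k + 1 + 3 = k by fin_cases k <;> rfl, faceAt, hu, cornerUnit_eq_off_sub]; abel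
    have hbond : plaqBond p (p + cornerUnit k) = cSrc (u, k + 1) := by rw [plaqBond_add_cornerUnit]; rfl
    have hend : u ∈ Λ ∨ u + cornerUnit (k + 1) ∈ Λ := by
      obtain ⟨x, hx, hxb⟩ := hfirst
      rw [hbond, cSrc, Sym2.mem_iff] at hxb
      rcases hxb with rfl | rfl
      · exact Or.inl hx
      · exact Or.inr hx
    obtain ⟨ht1, ht2⟩ := faceAt_mem_touchPlaquettes_of_endpoint hend
    rw [hf1] at ht1; rw [hf2] at ht2
    rcases h.step u (k + 1) (hf1 ▸ hP ht1) (hf2 ▸ hP ht2) with ⟨-, S, hS, hcut⟩ | ⟨hu', hu''⟩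
    · rw [hf1, hf2] at hcut
      have g1 : KCGaugeEquiv G₂ Λ (symmDiff (cut p) {cSrc (u, k + 1)}) (cut (p + cornerUnit k)) := ⟨S, hS, hcut⟩
      have g2 := g1.symmDiff_right' G₂ (crossSet W')
      rw [crossSet, hbond]
      rw [symmDiff_assoc] at g2
      rw [symmDiff_comm (crossSet W') {cSrc (u, k + 1)}]
      exact g2.trans G₂ ih
    · exfalso; rcases hend with hx | hx
      · exact hu' hx
      · exact hu'' hx

/-- The toggle sign is gauge invariant. [folklore] -/
theorem vToggleSign_symmDiff_edgeBoundary (T : Finset (Sym2 (Site 2))) (S : Finset (Site 2)) (x : Site 2) :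
    vToggleSign (symmDiff T (edgeBoundary (zdGraph 2) S)) x = vToggleSign T x := by
  rw [vToggleSign, vToggleSign]
  have hadj : (zdGraph 2).Adj x (x + cornerUnit 1) := cSrc_mem_edgeSet (x, 1)
  have hmem : s(x, x + cornerUnit 1) ∈ edgeBoundary (zdGraph 2) S ↔ (x ∈ S ↔ x + cornerUnit 1 ∉ S) := by
    rw [mk_mem_edgeBoundary_iff]; exact ⟨fun h => h.2, fun h => ⟨hadj, h⟩⟩
  have hk : kcSign (symmDiff T (edgeBoundary (zdGraph 2) S)) s(x, x + cornerUnit 1) =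
      kcSign T s(x, x + cornerUnit 1) * (-1) ^ ((if x ∈ S then 1 else 0) + (if x + cornerUnit 1 ∈ S then 1 else 0)) := by
    simp only [kcSign, Finset.mem_symmDiff, hmem]
    by_cases hT : s(x, x + cornerUnit 1) ∈ T <;> by_cases hx : x ∈ S <;> by_cases hx' : x + cornerUnit 1 ∈ S <;>
      simp [hT, hx, hx']
  rw [hk, mul_assoc, ← pow_add]
  congr 1
  apply neg_one_pow_eq_of_mod_two_eq
  have h1 := leftCount_symmDiff_mod_two x T (edgeBoundary (zdGraph 2) S)
  have h2 := leftCount_symmDiff_mod_two (x + cornerUnit 1) T (edgeBoundary (zdGraph 2) S)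
  have h3 := leftCount_edgeBoundary_mod_two x S
  have h4 := leftCount_edgeBoundary_mod_two (x + cornerUnit 1) S
  split_ifs at h3 h4 ⊢ <;> omega

/-- Gauge-equivalent cuts have the same toggle sign. [folklore] -/
theorem KCGaugeEquiv.vToggleSign_eq {Λ : Finset (Site 2)} (hG : ∀ v ∈ Λ, ∀ k : Fin 4, G₂.Adj v (v + cornerUnit k))
    (hle : G₂ ≤ zdGraph 2) {T T' : Finset (Sym2 (Site 2))} (h : KCGaugeEquiv G₂ Λ T T') (x : Site 2) :
    vToggleSign T' x = vToggleSign T x := by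
  obtain ⟨S, hS, rfl⟩ := h
  rw [edgeBoundary_eq_of_subset G₂ hG hle hS, vToggleSign_symmDiff_edgeBoundary]

open scoped Classical in
/-- **The lower-corner sign of a cut system issued from `p₀`**: if the cut of the source plaquette is
empty and `faceAt x 1` is reached from `p₀` by a usable dual walk, then
`vLowSign x = -(-1)^{[p₀ ∈ U(x)]} g₀(x₁)`, `U(x)` the half-strip left of the bond `{x, x+e₁}`
(the plaquette `faceAt x 1` itself lies in `U(x)`). [folklore] -/
theorem vLowSign_eq_of_source {Λ : Finset (Site 2)} (hG : ∀ v ∈ Λ, ∀ k : Fin 4, G₂.Adj v (v + cornerUnit k))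
    (hle : G₂ ≤ zdGraph 2) {cut : Site 2 → Finset (Sym2 (Site 2))} {P : Set (Site 2)}
    (h : IsKCCuts G₂ Λ cut P) (hP : ↑(touchPlaquettes Λ) ⊆ P) {p₀ : Site 2} (h0 : cut p₀ = ∅)
    {x : Site 2} (W : (zdGraph 2).Walk p₀ (faceAt x 1)) (hW : UsableWalk Λ W) :
    vLowSign B cut x = -(-1) ^ (if p₀ ∈ leftStrip x then 1 else 0) * rowSign B (x 1) := by
  have g := h.gaugeEquiv_crossSet G₂ hP W hW
  rw [h0, ← Finset.bot_eq_empty, bot_symmDiff] at g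
  rw [vLowSign, g.vToggleSign_eq G₂ hG hle, vToggleSign_crossSet]
  have hin : faceAt x 1 ∈ leftStrip x := by
    simp only [leftStrip, Set.mem_setOf_eq, faceAt, cornerOff, Pi.sub_apply]
    constructor <;> simp
  rw [if_pos hin, pow_add, pow_one]
  ring

end Observable

end Literature.Probability.LatticeModels
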